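import Summits.RiemannHypothesis.RiemannHypothesis.Theorems.Splittings.RobinFiniteCakePT

/-!
# RobinFiniteCakeTop — gen 19 «LAYER CAKE AT PT», part 8/10 (G): STAGE 2 — a second θ-window `[2.2·10²⁴, X]` priced by BKLNW 2021 App. A row `𝓑₁(56) = 4.4627·10⁻⁹` on `[e⁵⁶, e²⁵⁰⁰⁰]` (hypothesis `hK1`): `sq_theta_sub_div_le_b56`, `partialNicolasBetweenS56_holds`, `EbS_top56_lt` (`c(56) = 2.592`, budget `0.5035`, S²-price `6.351·10⁻²¹·√X`), the two-window consumer `mertensProdLt_of_offLine2` and the law `robinCA_below_of_cake2`.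

Cell rh-split, seat rh-split-robin-finite g19 (card `cards/SPLIT-robin-finite.md` §26); carved VERBATIM from
`HOME/rh-split-robin-finite/g19/SketchG19.lean` (sha16 c333eb23d46ea866) by `mk_carve.py`.  Nothing here bears on the truth of RH.

HONEST LABEL: SPLITTING SEARCH over kernel-typed RH-EQUIVALENCES; a splitting A ∧ B ⟹ RH is CONDITIONAL
bookkeeping unless A and B are both proved; nothing here bears on the truth of RH.
-/

set_option linter.dupNamespace false

noncomputable section

open Real Filter Finset
open scoped Chebyshev ComplexConjugate

namespace Summit.RiemannHypothesis.RiemannHypothesis.Theorems.Splittings.RobinFiniteC1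

open Literature.NumberTheory.LFunctions Literature.NumberTheory.DiophantineGeometry
open Literature.NumberTheory.LFunctions.SchoenfeldBound
open Literature.NumberTheory.LFunctions.NicolasJExplicit
open RobinAnalyticSharp
open Literature.NumberTheory.LFunctions.VdC.Num (rpow_le_of_pow_le le_rpow_of_pow_le)
open Summit.RiemannHypothesis.RiemannHypothesis.Theorems.Splittings.RobinFiniteE3
open Summit.RiemannHypothesis.RiemannHypothesis.Theorems.Splittings.RobinFiniteTail
  (zeroTailBound_tailH tailH_PT_le tailH_nonneg)
open Summit.RiemannHypothesis.RiemannHypothesis.Theorems.Splittings.RobinFiniteE1c (summable_tailTerm)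

section CakeTop

/-! ### C9 · STAGE 2 — a higher `θ`-side window `[2.2·10²⁴, X]` priced by BKLNW's `k = 1` row `𝓑₁(56) = 4.4627·10⁻⁹`

Above `X ≈ 5·10³⁰` the tree's `θ`-side S²-price `2.07·10⁻¹⁶·√X` (BKLNW 2021 §1.2, `k = 2`, ALL `x ≥ 10¹⁹`: `|θ(x) − x| < 3.79·10⁻⁵·x/log²x`)
exhausts the budget by itself.  BKLNW's supplementary table (arXiv:2002.11068, App. A, "Values for `𝓑_k(b₀)` in `|θ(x) − x| <
𝓑_k(b₀)·x/(log x)^k` … valid for `x ∈ [e^{b₀}, e^{25000}]`", row `b₀ = 56`: `𝓑₁(56) = 4.4627·10⁻⁹`) is 8 500 times sharper at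
`log x ≥ 56`; it enters in HYPOTHESIS position `hK1` and only through `S²(x) ≤ 𝓑₁(56)²/log³x`, i.e. the price `6.351·10⁻²¹·√X` on the
new top window `[2.2·10²⁴, X]` (`e⁵⁶ ≤ 2.2·10²⁴`), whose `G`-constant is `c(56) = 2.592` (`G_large2R` with `L₁ = 56`) and whose budget is
`(1 + 2/log(2.2·10²⁴))·D + 6.351·10⁻²¹·√X ≤ 0.5035`.  Below `2.2·10²⁴` the tree's window law `mertensProdLt_of_offLineR` is used as is. -/

set_option maxHeartbeats 400000 in
/-- The cake cost is non-negative for real `X ≥ 1` (`T ≥ 7`). -/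
theorem cakeCost_nonneg_of_one_le {T : ℝ} (hT : 7 ≤ T) {X : ℝ} (hX : 1 ≤ X) : 0 ≤ cakeCost T X := by
  have hT0 : 0 < T := by linarith
  have htH := tailH_nonneg hT
  have hX0 : 0 ≤ X := by linarith
  have b0 : 0 ≤ (X ^ (3 / 10 : ℝ) + 1) / 2 * ((Real.log (T / (2 * π)) + 1) / (π * T) + (184 + 30 * Real.log T) / T ^ 2) :=
    mul_nonneg (by positivity) htH
  have d1 : 0 ≤ (X ^ (13 / 40 : ℝ) - X ^ (3 / 10 : ℝ)) / 2 * (2 * (2 * (8922.2 * (4 : ℝ) ^ (7 / 12 : ℝ) * T ^ ((7 / 12 : ℝ) - 2) / (1 - (4 : ℝ) ^ ((7 / 12 : ℝ) - 2))))) :=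
    mul_nonneg (by linarith [Real.rpow_le_rpow_of_exponent_le hX (by norm_num : (3 / 10 : ℝ) ≤ 13 / 40)])
      (massExpr_nonneg (by norm_num) (by norm_num) hT0)
  have d2 : 0 ≤ (X ^ (7 / 20 : ℝ) - X ^ (13 / 40 : ℝ)) / 2 * (2 * (2 * (6837.2 * (4 : ℝ) ^ (8 / 15 : ℝ) * T ^ ((8 / 15 : ℝ) - 2) / (1 - (4 : ℝ) ^ ((8 / 15 : ℝ) - 2))))) :=
    mul_nonneg (by linarith [Real.rpow_le_rpow_of_exponent_le hX (by norm_num : (13 / 40 : ℝ) ≤ 7 / 20)])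
      (massExpr_nonneg (by norm_num) (by norm_num) hT0)
  have d3 : 0 ≤ (X ^ (3 / 8 : ℝ) - X ^ (7 / 20 : ℝ)) / 2 * (2 * (2 * (7906.9 * (4 : ℝ) ^ (7 / 15 : ℝ) * T ^ ((7 / 15 : ℝ) - 2) / (1 - (4 : ℝ) ^ ((7 / 15 : ℝ) - 2))))) :=
    mul_nonneg (by linarith [Real.rpow_le_rpow_of_exponent_le hX (by norm_num : (7 / 20 : ℝ) ≤ 3 / 8)])
      (massExpr_nonneg (by norm_num) (by norm_num) hT0)
  have d4 : 0 ≤ (X ^ (2 / 5 : ℝ) - X ^ (3 / 8 : ℝ)) / 2 * (2 * (2 * (5192.2 * (4 : ℝ) ^ (5 / 12 : ℝ) * T ^ ((5 / 12 : ℝ) - 2) / (1 - (4 : ℝ) ^ ((5 / 12 : ℝ) - 2))))) :=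
    mul_nonneg (by linarith [Real.rpow_le_rpow_of_exponent_le hX (by norm_num : (3 / 8 : ℝ) ≤ 2 / 5)])
      (massExpr_nonneg (by norm_num) (by norm_num) hT0)
  have d5 : 0 ≤ (X ^ (41 / 100 : ℝ) - X ^ (2 / 5 : ℝ)) / 2 * (2 * (2 * (24906 * (4 : ℝ) ^ (3 / 8 : ℝ) * T ^ ((3 / 8 : ℝ) - 2) / (1 - (4 : ℝ) ^ ((3 / 8 : ℝ) - 2))))) :=
    mul_nonneg (by linarith [Real.rpow_le_rpow_of_exponent_le hX (by norm_num : (2 / 5 : ℝ) ≤ 41 / 100)])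
      (massExpr_nonneg (by norm_num) (by norm_num) hT0)
  have d6 : 0 ≤ (X ^ (21 / 50 : ℝ) - X ^ (41 / 100 : ℝ)) / 2 * (2 * (2 * (18887 * (4 : ℝ) ^ (5 / 14 : ℝ) * T ^ ((5 / 14 : ℝ) - 2) / (1 - (4 : ℝ) ^ ((5 / 14 : ℝ) - 2))))) :=
    mul_nonneg (by linarith [Real.rpow_le_rpow_of_exponent_le hX (by norm_num : (41 / 100 : ℝ) ≤ 21 / 50)])
      (massExpr_nonneg (by norm_num) (by norm_num) hT0)
  have d7 : 0 ≤ (X ^ (43 / 100 : ℝ) - X ^ (21 / 50 : ℝ)) / 2 * (2 * (2 * (36427 * (4 : ℝ) ^ (4 / 13 : ℝ) * T ^ ((4 / 13 : ℝ) - 2) / (1 - (4 : ℝ) ^ ((4 / 13 : ℝ) - 2))))) :=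
    mul_nonneg (by linarith [Real.rpow_le_rpow_of_exponent_le hX (by norm_num : (21 / 50 : ℝ) ≤ 43 / 100)])
      (massExpr_nonneg (by norm_num) (by norm_num) hT0)
  have d8 : 0 ≤ (X ^ (11 / 25 : ℝ) - X ^ (43 / 100 : ℝ)) / 2 * (2 * (2 * (30387 * (4 : ℝ) ^ (2 / 7 : ℝ) * T ^ ((2 / 7 : ℝ) - 2) / (1 - (4 : ℝ) ^ ((2 / 7 : ℝ) - 2))))) :=
    mul_nonneg (by linarith [Real.rpow_le_rpow_of_exponent_le hX (by norm_num : (43 / 100 : ℝ) ≤ 11 / 25)])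
      (massExpr_nonneg (by norm_num) (by norm_num) hT0)
  have d9 : 0 ≤ (X ^ (9 / 20 : ℝ) - X ^ (11 / 25 : ℝ)) / 2 * (2 * (2 * (23407 * (4 : ℝ) ^ (4 / 15 : ℝ) * T ^ ((4 / 15 : ℝ) - 2) / (1 - (4 : ℝ) ^ ((4 / 15 : ℝ) - 2))))) :=
    mul_nonneg (by linarith [Real.rpow_le_rpow_of_exponent_le hX (by norm_num : (11 / 25 : ℝ) ≤ 9 / 20)])
      (massExpr_nonneg (by norm_num) (by norm_num) hT0)
  have d10 : 0 ≤ (X ^ (23 / 50 : ℝ) - X ^ (9 / 20 : ℝ)) / 2 * (2 * (2 * (30039 * (4 : ℝ) ^ (3 / 13 : ℝ) * T ^ ((3 / 13 : ℝ) - 2) / (1 - (4 : ℝ) ^ ((3 / 13 : ℝ) - 2))))) :=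
    mul_nonneg (by linarith [Real.rpow_le_rpow_of_exponent_le hX (by norm_num : (9 / 20 : ℝ) ≤ 23 / 50)])
      (massExpr_nonneg (by norm_num) (by norm_num) hT0)
  have d11 : 0 ≤ (X ^ (47 / 100 : ℝ) - X ^ (23 / 50 : ℝ)) / 2 * (2 * (2 * (21401 * (4 : ℝ) ^ (3 / 14 : ℝ) * T ^ ((3 / 14 : ℝ) - 2) / (1 - (4 : ℝ) ^ ((3 / 14 : ℝ) - 2))))) :=
    mul_nonneg (by linarith [Real.rpow_le_rpow_of_exponent_le hX (by norm_num : (23 / 50 : ℝ) ≤ 47 / 100)])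
      (massExpr_nonneg (by norm_num) (by norm_num) hT0)
  have d12 : 0 ≤ (X ^ (12 / 25 : ℝ) - X ^ (47 / 100 : ℝ)) / 2 * (2 * (2 * (24602 * (4 : ℝ) ^ (2 / 11 : ℝ) * T ^ ((2 / 11 : ℝ) - 2) / (1 - (4 : ℝ) ^ ((2 / 11 : ℝ) - 2))))) :=
    mul_nonneg (by linarith [Real.rpow_le_rpow_of_exponent_le hX (by norm_num : (47 / 100 : ℝ) ≤ 12 / 25)])
      (massExpr_nonneg (by norm_num) (by norm_num) hT0)
  have d13 : 0 ≤ (X ^ (49 / 100 : ℝ) - X ^ (12 / 25 : ℝ)) / 2 * (2 * (2 * (24770 * (4 : ℝ) ^ (2 / 13 : ℝ) * T ^ ((2 / 13 : ℝ) - 2) / (1 - (4 : ℝ) ^ ((2 / 13 : ℝ) - 2))))) :=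
    mul_nonneg (by linarith [Real.rpow_le_rpow_of_exponent_le hX (by norm_num : (12 / 25 : ℝ) ≤ 49 / 100)])
      (massExpr_nonneg (by norm_num) (by norm_num) hT0)
  have d14 : 0 ≤ (X ^ (1 / 2 : ℝ) - X ^ (49 / 100 : ℝ)) / 2 * (2 * (2 * (25594 * (4 : ℝ) ^ (1 / 8 : ℝ) * T ^ ((1 / 8 : ℝ) - 2) / (1 - (4 : ℝ) ^ ((1 / 8 : ℝ) - 2))))) :=
    mul_nonneg (by linarith [Real.rpow_le_rpow_of_exponent_le hX (by norm_num : (49 / 100 : ℝ) ≤ 1 / 2)])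
      (massExpr_nonneg (by norm_num) (by norm_num) hT0)
  unfold cakeCost
  linarith

/-- From the printed row (hypothesis `hK1`): `S²(x) = (θ(x) − x)²/(x² log x) ≤ (4.4627·10⁻⁹)²/log³x` on `[e⁵⁶, e²⁵⁰⁰⁰]`. -/
theorem sq_theta_sub_div_le_b56 (hK1 : ∀ x : ℝ, Real.exp 56 ≤ x → x ≤ Real.exp 25000 → |θ x - x| < 4.4627e-9 * x / Real.log x)
    {x : ℝ} (hx : Real.exp 56 ≤ x) (hx' : x ≤ Real.exp 25000) :
    (θ x - x) ^ 2 / (x ^ 2 * Real.log x) ≤ 4.4627e-9 ^ 2 / Real.log x ^ 3 := by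
  have hx0 : 0 < x := lt_of_lt_of_le (Real.exp_pos 56) hx
  have hlog : 56 ≤ Real.log x := by
    rw [Real.le_log_iff_exp_le hx0]; exact hx
  have hlog0 : 0 < Real.log x := by linarith
  have h1 := hK1 x hx hx'
  have h2 : (θ x - x) ^ 2 ≤ (4.4627e-9 * x / Real.log x) ^ 2 := by
    rw [← sq_abs]
    exact pow_le_pow_left₀ (abs_nonneg _) h1.le 2
  have e : (4.4627e-9 * x / Real.log x) ^ 2 * Real.log x ^ 3 = 4.4627e-9 ^ 2 * (x ^ 2 * Real.log x) := by
    rw [div_pow, div_mul_eq_mul_div, div_eq_iff (pow_ne_zero 2 hlog0.ne')]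
    ring
  rw [div_le_div_iff₀ (by positivity) (by positivity)]
  calc (θ x - x) ^ 2 * Real.log x ^ 3 ≤ (4.4627e-9 * x / Real.log x) ^ 2 * Real.log x ^ 3 :=
        mul_le_mul_of_nonneg_right h2 (by positivity)
    _ = 4.4627e-9 ^ 2 * (x ^ 2 * Real.log x) := e

/-- **The E-side on a window `[X₀, X₁] ⊂ [e⁵⁶, e²⁵⁰⁰⁰]`, `X₀ ≥ 10¹⁹`** (copy of gen 13's `partialNicolasBetweenS_holds` with the S²-term
from `hK1`): `−log f(x) ≤ Eb(0.0463 + (1 + 2/log X₀)·D) x + ((4.4627·10⁻⁹)²/log³x − log³x/(64π²x))`. -/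
theorem partialNicolasBetweenS56_holds (hB : Buthe2018_thm2_theta) (hK : BroadbentEtAl2021_theta_rel_1e19)
    (hK1 : ∀ x : ℝ, Real.exp 56 ≤ x → x ≤ Real.exp 25000 → |θ x - x| < 4.4627e-9 * x / Real.log x)
    {T D X₀ X₁ : ℝ}
    (hoff : ∀ x : ℝ, X₀ ≤ x → x ≤ X₁ →
      ∑' ρ : RHWave0.riemannZetaNontrivialZeros,
        (if T < |(ρ : ℂ).im| then
          (riemannZetaZeroOrder (ρ : ℂ) : ℝ) * x ^ ((ρ : ℂ).re - 1 / 2) / (ρ : ℂ).im ^ 2 else 0) ≤ D)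
    (hD : 0 ≤ D) (hX₀ : (10 : ℝ) ^ 19 ≤ X₀) (hX₀e : Real.exp 56 ≤ X₀) (hX₁ : X₁ ≤ Real.exp 25000)
    (hT : RiemannHypothesisUpTo T) :
    ∀ x : ℝ, X₀ ≤ x → x ≤ X₁ →
      -Real.log (nicolasF x) ≤ (RobinAnalyticSharp.nicolasERH x +
          (0.0463 + (1 + 2 / Real.log X₀) * D - nicolasBeta) *
            (1 / (√x * Real.log x) + 1 / (√x * Real.log x ^ 2) + 4 / (√x * Real.log x ^ 3))) +
        (4.4627e-9 ^ 2 / Real.log x ^ 3 - Real.log x ^ 3 / (64 * π ^ 2 * x)) := by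
  intro x hx0 hx1
  have hx19 : (10 : ℝ) ^ 19 ≤ x := hX₀.trans hx0
  have hx : (599 : ℝ) ≤ x := le_trans (by norm_num) hx19
  have hx15 : (2 : ℝ) ^ 15 ≤ x := le_trans (by norm_num) hx19
  have hθ45 : 4 / 5 * x ≤ θ x := by
    have := theta_ge_975R hB hK hx15
    linarith
  have h := corePwLowerS_of_stubs Summit.RiemannHypothesis.RiemannHypothesis.Theorems.Splittings.RobinFiniteE1c.explicitFormulaFree_holds Summit.RiemannHypothesis.RiemannHypothesis.Theorems.Splittings.RobinFiniteE1c.zeroSplitBound_holds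
    (Summit.RiemannHypothesis.RiemannHypothesis.Theorems.Splittings.RobinFiniteE1c.psiSubThetaFree_holds hB hK)
    T x D _ hx hD hT hθ45 (sq_theta_sub_div_le_b56 hK1 (hX₀e.trans hx0) (hx1.trans hX₁)) (hoff x hx0 hx1)
  have hX₀1 : (1 : ℝ) < X₀ := lt_of_lt_of_le (by norm_num) hX₀
  have hmono := Summit.RiemannHypothesis.RiemannHypothesis.Theorems.Splittings.RobinFiniteE1c.nicolasEWith_mono (x := x) (by linarith) (budgetPw1_anti hD hX₀1 hx0)
  linarith

/-- Enclosure: `e⁵⁶ ≤ 2.2·10²⁴` (`e < 2.7182818286`). -/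
theorem exp_56_le : Real.exp 56 ≤ 2.2e24 := by
  have h := Real.exp_one_lt_d9
  have e : Real.exp 56 = Real.exp 1 ^ 56 := by rw [← Real.exp_nat_mul]; norm_num
  rw [e]
  calc Real.exp 1 ^ 56 ≤ 2.7182818286 ^ 56 := pow_le_pow_left₀ (Real.exp_pos 1).le h.le 56
    _ ≤ 2.2e24 := by norm_num

/-- Enclosure: `56 ≤ log(2.2·10²⁴)`. -/
theorem log_2p2e24_ge : (56 : ℝ) ≤ Real.log 2.2e24 := by
  rw [Real.le_log_iff_exp_le (by norm_num)]; exact exp_56_le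

/-- Enclosure: `43e33 ≤ e⁸⁰ ≤ e²⁵⁰⁰⁰` (`e > 2.7182818283`). -/
theorem X2_le_exp_25000 : (43e33 : ℝ) ≤ Real.exp 25000 := by
  have h := Real.exp_one_gt_d9
  have e : Real.exp 80 = Real.exp 1 ^ 80 := by rw [← Real.exp_nat_mul]; norm_num
  have h80 : (43e33 : ℝ) ≤ Real.exp 80 := by
    rw [e]
    calc (43e33 : ℝ) ≤ 2.7182818283 ^ 80 := by norm_num
      _ ≤ Real.exp 1 ^ 80 := pow_le_pow_left₀ (by norm_num) h.le 80
  exact h80.trans (Real.exp_le_exp.2 (by norm_num))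

/-- The budget factor of the new window: `1 + 2/log(2.2·10²⁴) ≤ 1 + 2/56 ≤ 1.0357143`. -/
theorem budgetFactor56_le : 1 + 2 / Real.log (2.2e24 : ℝ) ≤ 1.0357143 := by
  have h : 2 / Real.log (2.2e24 : ℝ) ≤ 2 / 56 := div_le_div_of_nonneg_left (by norm_num) (by norm_num) log_2p2e24_ge
  linarith

/-- **The new top window `[2.2·10²⁴, X]` against `c(56) = 2.592`**: if `(1 + 2/log(2.2·10²⁴))·t + 6.351·10⁻²¹·√X ≤ 0.5035` then for
`2.2·10²⁴ ≤ P ≤ X`: `(Eb(0.0463 + (1 + 2/log(2.2·10²⁴))·t) P + ((4.4627·10⁻⁹)²/log³P − log³P/(64π²P)))·√P log P < 2.592` — box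
`EbS_mul_le_box_top` with `L₁ = 56`, `s₁ = 1 483 239 697 419 ≤ √(2.2·10²⁴)`, `y₁ = 11400 ≤ (2.2·10²⁴)^{1/6}`, and the S²-price
`(4.4627·10⁻⁹)²·√P/log²P ≤ 6.351·10⁻²¹·√X`. -/
theorem EbS_top56_lt {P X t : ℝ} (h0 : (2.2e24 : ℝ) ≤ P) (hPX : P ≤ X)
    (hκ : (1 + 2 / Real.log (2.2e24 : ℝ)) * t + 6.351e-21 * √X ≤ 0.5035) :
    (nicolasERH P + ((0.0463 + (1 + 2 / Real.log (2.2e24 : ℝ)) * t) - nicolasBeta) *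
          (1 / (√P * Real.log P) + 1 / (√P * Real.log P ^ 2) + 4 / (√P * Real.log P ^ 3)) +
        (4.4627e-9 ^ 2 / Real.log P ^ 3 - Real.log P ^ 3 / (64 * π ^ 2 * P))) * (√P * Real.log P) < 2.592 := by
  have hL := log_2p2e24_ge
  obtain ⟨hs, -⟩ := sqrt_between (s := 1483239697419) (u := 1483239697420) (X := (2.2e24 : ℝ))
    (by norm_num) (by norm_num) (by norm_num)
  have hy := le_rpow_sixth (X := (2.2e24 : ℝ)) (y := 11400) (by norm_num) (by norm_num)
  have hP0 : 0 < P := lt_of_lt_of_le (by norm_num) h0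
  have hLP : (56 : ℝ) ≤ Real.log P := hL.trans (Real.log_le_log (by norm_num) h0)
  have hLP0 : 0 < Real.log P := by linarith
  have hsX : √P ≤ √X := Real.sqrt_le_sqrt hPX
  have hsX0 : 0 ≤ √X := Real.sqrt_nonneg X
  have hsP0 : 0 ≤ √P := Real.sqrt_nonneg P
  have hS : 4.4627e-9 ^ 2 / Real.log P ^ 3 * (√P * Real.log P) ≤ 6.351e-21 * √X := by
    have e : 4.4627e-9 ^ 2 / Real.log P ^ 3 * (√P * Real.log P) = 4.4627e-9 ^ 2 * √P / Real.log P ^ 2 := by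
      field_simp
    rw [e, div_le_iff₀ (by positivity)]
    have hL2 : (56 : ℝ) ^ 2 ≤ Real.log P ^ 2 := pow_le_pow_left₀ (by norm_num) hLP 2
    calc 4.4627e-9 ^ 2 * √P ≤ 4.4627e-9 ^ 2 * √X := by gcongr
      _ ≤ 6.351e-21 * √X * (56 : ℝ) ^ 2 := by nlinarith [hsX0]
      _ ≤ 6.351e-21 * √X * Real.log P ^ 2 := by gcongr
  have hb68 : 0.0463 + (1 + 2 / Real.log (2.2e24 : ℝ)) * t ≤ 0.68 := by
    set L0 : ℝ := Real.log (2.2e24 : ℝ) with hL0_def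
    nlinarith [hsX0]
  have hbox := EbS_mul_le_box_top (P := P) (q := 4.4627e-9 ^ 2 / Real.log P ^ 3)
    (b := 0.0463 + (1 + 2 / Real.log (2.2e24 : ℝ)) * t) hb68 (by norm_num) h0 hL
    (by norm_num) hs (by norm_num) hy (by norm_num)
  have hnum : (1.84 : ℝ) / 1483239697419 + 2 / 11400 < 2.592 - 2.042 - 0.0463 - 0.5035 := by norm_num
  clear hs hy
  set L0 : ℝ := Real.log (2.2e24 : ℝ) with hL0_def
  nlinarith [hsX0]

/-- **Two-window consumer**: RH to height `T ≥ H₀`; the tree's three `θ`-facts; the BKLNW `k = 1` row (`hK1`); off-line bounds `Dm`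
on `[2·10²², 2.2·10²⁴]` (tree budget `0.4857`, tree S²-price) and `D` on `[2.2·10²⁴, X]` (budget `0.5035`, S²-price `6.351·10⁻²¹·√X`)
give the CA Mertens inequality for `4¹¹ ≤ P ≤ X`, `Q ≤ P`.  Below `2.2·10²⁴`: `mertensProdLt_of_offLineR` verbatim. -/
theorem mertensProdLt_of_offLine2 (h16 : Buthe2016_thm2) (hB : Buthe2018_thm2_theta)
    (hK : BroadbentEtAl2021_theta_rel_1e19)
    (hK1 : ∀ x : ℝ, Real.exp 56 ≤ x → x ≤ Real.exp 25000 → |θ x - x| < 4.4627e-9 * x / Real.log x)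
    {T : ℝ} (hT : 3000175332800 ≤ T) (hRH : RiemannHypothesisUpTo T) {X Dm D : ℝ}
    (hoffm : ∀ x : ℝ, 2 * (10 : ℝ) ^ 22 ≤ x → x ≤ (2.2e24 : ℝ) →
      ∑' ρ : RHWave0.riemannZetaNontrivialZeros,
        (if T < |(ρ : ℂ).im| then
          (riemannZetaZeroOrder (ρ : ℂ) : ℝ) * x ^ ((ρ : ℂ).re - 1 / 2) / (ρ : ℂ).im ^ 2 else 0) ≤ Dm)
    (hDm : 0 ≤ Dm) (hκm : (1 + 2 / Real.log (2 * (10 : ℝ) ^ 22)) * Dm + 2.07e-16 * √(2.2e24 : ℝ) ≤ 0.4857)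
    (hoff : ∀ x : ℝ, (2.2e24 : ℝ) ≤ x → x ≤ X →
      ∑' ρ : RHWave0.riemannZetaNontrivialZeros,
        (if T < |(ρ : ℂ).im| then
          (riemannZetaZeroOrder (ρ : ℂ) : ℝ) * x ^ ((ρ : ℂ).re - 1 / 2) / (ρ : ℂ).im ^ 2 else 0) ≤ D)
    (hD : 0 ≤ D) (hXe : X ≤ Real.exp 25000)
    (hκ : (1 + 2 / Real.log (2.2e24 : ℝ)) * D + 6.351e-21 * √X ≤ 0.5035)
    {P Q : ℕ} (hP : 4 ^ 11 ≤ P) (hPX : (P : ℝ) ≤ X) (hQP : Q ≤ P) :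
    (∏ p ∈ Nat.primesLE P, (1 - (p : ℝ)⁻¹))⁻¹ *
        ∏ p ∈ (Nat.primesLE P).filter (fun p => Q < p), (1 - ((p : ℝ) ^ 2)⁻¹) <
      rexp eulerMascheroniConstant * Real.log (θ P + θ Q) := by
  rcases le_or_gt (P : ℝ) (2.2e24 : ℝ) with hlo | hhi
  · exact mertensProdLt_of_offLineR h16 hB hK hT hRH hoffm hDm hκm hP hlo hQP
  · have h24 : (2.2e24 : ℝ) ≤ P := hhi.le
    have hPr : (4 : ℝ) ^ 11 ≤ P := by exact_mod_cast hP
    have hP1 : (1 : ℝ) < P := by linarith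
    have hbig19 : (2 * 10 ^ 19 : ℝ) ≤ P := le_trans (by norm_num) h24
    have hlow := partialNicolasBetweenS56_holds hB hK hK1 (T := T) (X₀ := (2.2e24 : ℝ)) (X₁ := X)
      hoff hD (by norm_num) exp_56_le hXe hRH P h24 hPX
    have hsL : 0 < √(P : ℝ) * Real.log P := mul_pos (Real.sqrt_pos.2 (by linarith)) (Real.log_pos hP1)
    have hlt := EbS_top56_lt h24 hPX hκ
    have hL₁P : (56 : ℝ) ≤ Real.log P := log_2p2e24_ge.trans (Real.log_le_log (by norm_num) h24)
    have hG := G_large2R hB hK hbig19 hQP hL₁P (by norm_num) (c := 2.592) (by norm_num) (by norm_num)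
    exact mertens_prod_lt_ofR hP hlow (((lt_div_iff₀ hsL).2 hlt).trans_le hG)

open scoped ArithmeticFunction.sigma in
/-- **Robin at CA numbers from the two-window consumer** (copy of gen 13's `robinCA_below_of_offLineR`). Nothing here bears on the
truth of RH. -/
theorem robinCA_below_of_offLine2 (h16 : Buthe2016_thm2) (hB : Buthe2018_thm2_theta)
    (hK : BroadbentEtAl2021_theta_rel_1e19)
    (hK1 : ∀ x : ℝ, Real.exp 56 ≤ x → x ≤ Real.exp 25000 → |θ x - x| < 4.4627e-9 * x / Real.log x)
    {T : ℝ} (hT : 3000175332800 ≤ T) (hRH : RiemannHypothesisUpTo T) {X : ℕ} {Dm D : ℝ}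
    (hoffm : ∀ x : ℝ, 2 * (10 : ℝ) ^ 22 ≤ x → x ≤ (2.2e24 : ℝ) →
      ∑' ρ : RHWave0.riemannZetaNontrivialZeros,
        (if T < |(ρ : ℂ).im| then
          (riemannZetaZeroOrder (ρ : ℂ) : ℝ) * x ^ ((ρ : ℂ).re - 1 / 2) / (ρ : ℂ).im ^ 2 else 0) ≤ Dm)
    (hDm : 0 ≤ Dm) (hκm : (1 + 2 / Real.log (2 * (10 : ℝ) ^ 22)) * Dm + 2.07e-16 * √(2.2e24 : ℝ) ≤ 0.4857)
    (hoff : ∀ x : ℝ, (2.2e24 : ℝ) ≤ x → x ≤ (X : ℝ) →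
      ∑' ρ : RHWave0.riemannZetaNontrivialZeros,
        (if T < |(ρ : ℂ).im| then
          (riemannZetaZeroOrder (ρ : ℂ) : ℝ) * x ^ ((ρ : ℂ).re - 1 / 2) / (ρ : ℂ).im ^ 2 else 0) ≤ D)
    (hD : 0 ≤ D) (hXe : (X : ℝ) ≤ Real.exp 25000)
    (hκ : (1 + 2 / Real.log (2.2e24 : ℝ)) * D + 6.351e-21 * √(X : ℝ) ≤ 0.5035) :
    robinCA_below (X + 1) := by
  intro N hCA h5040 hprimes
  obtain ⟨ε, P, Q, -, -, hP, hPN, -, hQP, hpf, -, -, hσ, hθ, -⟩ := hCA.exists_structure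
  by_cases hsmall : P < 4 ^ 11
  · refine robinCA_below_four_pow_eleven N hCA h5040 fun p hp hpN => lt_of_le_of_lt ?_ hsmall
    have hN0 : N ≠ 0 := by omega
    have : p ∈ N.primeFactors := Nat.mem_primeFactors.2 ⟨hp, hpN, hN0⟩
    rw [hpf] at this
    exact (Nat.mem_primesLE.1 this).1
  · rw [not_lt] at hsmall
    have hPX : (P : ℝ) ≤ X := by
      have := hprimes P hP hPN
      exact_mod_cast Nat.lt_succ_iff.1 this
    have hlt := mertensProdLt_of_offLine2 h16 hB hK hK1 hT hRH hoffm hDm hκm hoff hD hXe hκ hsmall hPX hQP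
    have hN0 : N ≠ 0 := by omega
    have hNpos : (0 : ℝ) < N := by exact_mod_cast Nat.pos_of_ne_zero hN0
    have hθpos : 0 < θ P + θ Q := by
      have h1 : 0 < θ (P : ℝ) := Chebyshev.theta_pos (by exact_mod_cast hP.two_le)
      have h2 : 0 ≤ θ (Q : ℝ) := Chebyshev.theta_nonneg _
      linarith
    have hlog : Real.log (θ P + θ Q) ≤ Real.log (Real.log N) := Real.log_le_log hθpos hθ
    have hlt' : (σ 1 N : ℝ) / N < rexp eulerMascheroniConstant * Real.log (Real.log N) :=
      lt_of_le_of_lt hσ (hlt.trans_le (mul_le_mul_of_nonneg_left hlog (Real.exp_pos _).le))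
    unfold robinInequality
    rw [div_lt_iff₀ hNpos] at hlt'
    linarith

/-- **THE TWO-WINDOW CAKE LAW**: the three `θ`-facts, the BKLNW `k = 1` row (`hK1`), the two density inputs (`hCS`, `hF5`) and RH to
ANY height `T ≥ H₀` give Robin at every CA number `N > 5040` with primes `≤ X ≤ e²⁵⁰⁰⁰`, whenever
`(1 + 2/log(2·10²²))·cakeCost(T, 2.2·10²⁴) + 2.07·10⁻¹⁶·√(2.2·10²⁴) ≤ 0.4857` and
`(1 + 2/log(2.2·10²⁴))·cakeCost(T, X) + 6.351·10⁻²¹·√X ≤ 0.5035`.  Nothing here bears on the truth of RH. -/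
theorem robinCA_below_of_cake2 (h16 : Buthe2016_thm2) (hB : Buthe2018_thm2_theta) (hK : BroadbentEtAl2021_theta_rel_1e19)
    (hK1 : ∀ x : ℝ, Real.exp 56 ≤ x → x ≤ Real.exp 25000 → |θ x - x| < 4.4627e-9 * x / Real.log x)
    (hCS : ChourasiyaSimonic2025_cor1)
    (hF5 : FioriKadiriSwidinsky2023_table5) {T : ℝ} (hT : 3000175332800 ≤ T) (hRH : RiemannHypothesisUpTo T) {X : ℕ}
    (hXe : (X : ℝ) ≤ Real.exp 25000)
    (hκm : (1 + 2 / Real.log (2 * (10 : ℝ) ^ 22)) * cakeCost T (2.2e24 : ℝ) + 2.07e-16 * √(2.2e24 : ℝ) ≤ 0.4857)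
    (hκ : (1 + 2 / Real.log (2.2e24 : ℝ)) * cakeCost T (X : ℝ) + 6.351e-21 * √(X : ℝ) ≤ 0.5035) :
    robinCA_below (X + 1) := by
  have hT12 : 3 * (10 : ℝ) ^ 12 ≤ T := le_trans (by norm_num) hT
  have hT7 : (7 : ℝ) ≤ T := le_trans (by norm_num) hT
  exact robinCA_below_of_offLine2 h16 hB hK hK1 hT hRH
    (fun x hx hxX => offLine_le_cake hCS hF5 hT12 (le_trans (by norm_num) hx) hxX)
    (cakeCost_nonneg_of_one_le hT7 (by norm_num)) hκm
    (fun x hx hxX => offLine_le_cake hCS hF5 hT12 (le_trans (by norm_num) hx) hxX)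
    (cakeCost_natCast_nonneg hT7 X) hXe hκ

end CakeTop

end Summit.RiemannHypothesis.RiemannHypothesis.Theorems.Splittings.RobinFiniteC1

end
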